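import Mathlib
import HarnessLib
import Summits.CriticalPhenomena.PercolationContinuityZ3.Theses.PercLowPointHalfSpace
import Literature.Probability.Percolation.HalfSpacePinnedPairs

/-!
# Sketch (crux-ideate k=1, stmt-CriticalPhenomena-14713 `LowPointBookkeeping`): first lemmas

Elaboration-only sketch of the first checkable statements of two idea cards:
* `floor-density-russo-pair-overlap` — the floor-diluted half-space family and the
  disjoint-pair overlap bound `S(n) ≤ ∫₀¹ 𝔇_s(n) ds`;
* `tail-to-decoration-markov-split` — the Markov split on a repulsion event and the
  conditional-mass tail statement `MassTail`.
Nothing here is proved; `sorry` marks the statements to be proved by the line.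
-/

noncomputable section

namespace Summit.CriticalPhenomena.PercolationContinuityZ3.Cruxes.LowPointBookkeeping.SketchK1

open MeasureTheory Filter Topology ProbabilityTheory
open Literature.Probability.Percolation Literature.Probability.LatticeModels
open scoped ENNReal

/-- The critical measure on `ℤ³` (shorthand). -/
abbrev μc : Measure (BondConfig (Site 3)) := bondPercolation (zdGraph 3) (criticalProbI 3)

/-- The half-space `ℍ = {x₀ ≥ 0}` and its upper part `ℍ₊ = {x₀ ≥ 1}`. -/
abbrev Hs : Set (Site 3) := {x | 0 ≤ x 0}
abbrev Hp : Set (Site 3) := {x | 1 ≤ x 0}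

/-- FLOOR EDGES: lattice edges with both endpoints on the floor `∂ℍ = {x₀ = 0}`. -/
def floorEdges : Set (Sym2 (Site 3)) :=
  {f | ∃ x y : Site 3, f = s(x, y) ∧ x 0 = 0 ∧ y 0 = 0}

/-- Floor dilution of a configuration `ω` by a "coin" configuration `ξ`: a floor edge stays open
iff it is open in `ω` AND selected by `ξ`; all other edges are those of `ω`. -/
def floorDilute (ω ξ : BondConfig (Site 3)) : BondConfig (Site 3) := ω \ (floorEdges \ ξ)

/-- The FLOOR-DILUTED FAMILY `P_s`, `s ∈ [0,1]`: bulk at `p_c(ℤ³)`, floor edges at density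
`s · p_c` (`s = 1`: the real model; `s = 0`: floor edges absent, floor vertices pendant). -/
def floorDiluted (s : unitInterval) : Measure (BondConfig (Site 3)) :=
  (μc.prod (setBer(floorEdges, s))).map fun p => floorDilute p.1 p.2

/-- ENDPOINT `s = 0` (deterministic): for points of `ℍ₊`, connection in `ℍ` using no floor edge is
connection in `ℍ₊` (a path entering a floor vertex can only leave through the same vertical edge). -/
theorem floorDilute_empty_mem_openConnIn_iff (ω : BondConfig (Site 3)) (a b : Site 3)
    (ha : 1 ≤ a 0) (hb : 1 ≤ b 0) :
    floorDilute ω ∅ ∈ openConnIn Hs a b ↔ ω ∈ openConnIn Hp a b := by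
  sorry

/-- ENDPOINT `s = 1`: no dilution. -/
theorem floorDiluted_one : floorDiluted 1 = μc := by
  sorry

/-- The DISJOINT-PAIR OVERLAP at shift `w` under `P_s`: expected number of `v ∈ ℍ₊` with
`v ∈ C_ℍ(0)`, `v + w ∈ C_ℍ(e)` and `0 ↮_ℍ e`, summed over the four floor neighbours `e` of `0`. -/
def pairOverlap (s : unitInterval) (w : Site 3) : ℝ≥0∞ :=
  ∑ e ∈ ({Pi.single 1 1, Pi.single 1 (-1), Pi.single 2 1, Pi.single 2 (-1)} : Finset (Site 3)),
    ∑' v : Site 3, (floorDiluted s)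
      ({ω | 1 ≤ v 0} ∩ openConnIn Hs 0 v ∩ openConnIn Hs e (v + w) ∩ (openConnIn Hs 0 e)ᶜ)

/-- FIRST LEMMA of the line `floor-density-russo-pair-overlap` (Russo in the floor density +
column telescoping): the cross-bush term `S(n) = τ(0, n e₀) − τ_ℍ(0, n e₀)` is bounded by the
floor-density integral of the disjoint-pair overlap at shift `n e₀`. -/
theorem crossTerm_le_integral_pairOverlap (n : ℕ) :
    μc (openConn (0 : Site 3) (Pi.single 0 (n : ℤ))) -
        μc (openConnIn Hs 0 (Pi.single 0 (n : ℤ))) ≤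
      ∫⁻ s : unitInterval, pairOverlap s (Pi.single 0 (n : ℤ)) := by
  sorry

/-- `B_s` FROM `B` (monotone coupling): the tall-conditioned mass under floor dilution is bounded by
the undiluted one — the integrand `|C ∩ B_r|·1{tall}` is increasing and `P_s ≤ P_1` in the
standard coupling. -/
theorem tallMass_floorDiluted_le (s : unitInterval) (r : ℕ) :
    ∑ x ∈ box 3 r, (floorDiluted s) (openConnIn Hs 0 x ∩
        {ω | ∃ y : Site 3, (∃ i : Fin 3, (r : ℤ) ≤ |y i|) ∧ ω ∈ openConnIn Hs 0 y}) ≤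
      ∑ x ∈ box 3 r, μc (openConnIn Hs 0 x ∩
        {ω | ∃ y : Site 3, (∃ i : Fin 3, (r : ℤ) ≤ |y i|) ∧ ω ∈ openConnIn Hs 0 y}) := by
  sorry

/-- One-step regularity of the boundary arm (for `B_s`, `C_s` transfer): `π_s(r+1) ≥ p_c · π_s(r)`. -/
theorem tall_succ_ge (r : ℕ) :
    ENNReal.ofReal (criticalProb (zdGraph 3) (0 : Site 3)) *
        μc {ω | ∃ y : Site 3, (∃ i : Fin 3, (r : ℤ) ≤ |y i|) ∧ ω ∈ openConnIn Hs 0 y} ≤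
      μc {ω | ∃ y : Site 3, (∃ i : Fin 3, ((r : ℤ) + 1) ≤ |y i|) ∧ ω ∈ openConnIn Hs 0 y} := by
  sorry

/-! ## Card `tail-to-decoration-markov-split` -/

/-- MARKOV SPLIT on a sub-event (pure measure theory): for `J ⊆ T` and `N ≥ 0`,
`∫_J N ≤ λ·μ(J) + ∫_{T ∩ {N > λ}} N`. Decorations on a repulsion event `J` cost `λ` times the
repulsion probability plus a ONE-cluster tail term. -/
theorem lintegral_inter_le_mul_add_tail {α : Type*} [MeasurableSpace α] (μ : Measure α)
    {J T : Set α} (hJT : J ⊆ T) (hT : MeasurableSet T) (N : α → ℝ≥0∞) (hN : Measurable N)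
    (lam : ℝ≥0∞) :
    ∫⁻ ω in J, N ω ∂μ ≤ lam * μ J + ∫⁻ ω in T ∩ {ω | lam < N ω}, N ω ∂μ := by
  sorry

/-- `MassTail` (a `B∞`-type statement, STRONGER than `TallClusterMassBound`): stretched-exponential
upper tail of the conditional mass `|C_ℍ(0) ∩ B_{2r}| / r^{11/4}` of `r`-tall critical wall clusters
(mass in the DOUBLE ball, so that a cluster of radius `R ∈ [r, 2r)` is covered entirely — this sidesteps the
extremal-shell typing gap of `TallClusterMassBound`, NOTES B1). -/
def MassTail : Prop :=
  ∃ C c δ : ℝ, 0 < c ∧ 0 < δ ∧ ∀ r : ℕ, 1 ≤ r → ∀ lam : ℝ, 1 ≤ lam →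
    μc.real ({ω | lam * (r : ℝ) ^ ((11 : ℝ) / 4) <
        ((halfSpaceCluster ω ∩ (↑(box 3 (2 * r)) : Set (Site 3))).ncard : ℝ)} ∩
      {ω | ∃ y : Site 3, (∃ i : Fin 3, (r : ℤ) ≤ |y i|) ∧ ω ∈ openConnIn Hs 0 y}) ≤
    C * Real.exp (-c * lam ^ δ) *
      μc.real {ω | ∃ y : Site 3, (∃ i : Fin 3, (r : ℤ) ≤ |y i|) ∧ ω ∈ openConnIn Hs 0 y}

/-- DECORATED REPULSION from `MassTail` (shape of the reduction; `J r` = any event contained in the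
`r`-tall event, e.g. the two-arm repulsion event of `BoundaryTwoArmDecay`): with `λ = (K log r)^{1/δ}`
the decorated term is `≤ C r^{11/4} (log r)^{C'} P(J r) + C r^{-10}`. -/
theorem decorated_le_of_massTail (hMT : MassTail) :
    ∃ C C' : ℝ, ∀ r : ℕ, 2 ≤ r → ∀ J : Set (BondConfig (Site 3)), MeasurableSet J →
      J ⊆ {ω | ∃ y : Site 3, (∃ i : Fin 3, (r : ℤ) ≤ |y i|) ∧ ω ∈ openConnIn Hs 0 y} →
      ∑ x ∈ box 3 r, μc.real (openConnIn Hs 0 x ∩ J) ≤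
        C * (r : ℝ) ^ ((11 : ℝ) / 4) * Real.log r ^ C' * μc.real J + C * (r : ℝ) ^ (-(10 : ℝ)) := by
  sorry


/-- `LocalMassTail`: the same stretched-exponential tail for the LOCAL mass of an `r`-tall wall
cluster in sub-boxes of side `n ≤ r` anywhere in `B_{3r}` (max over positions; one-cluster). With
`MassTail` it strips the doubly-decorated Region-II term of the bookkeeping to the undecorated
two-arm event whenever the exponent of `BoundaryTwoArmDecay` exceeds `11/4` (NOTES: threshold ladder). -/
def LocalMassTail : Prop :=
  ∃ C c δ : ℝ, 0 < c ∧ 0 < δ ∧ ∀ r n : ℕ, 1 ≤ n → n ≤ r → ∀ lam : ℝ, 1 ≤ lam →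
    μc.real ({ω | ∃ y ∈ box 3 (3 * r), lam * (n : ℝ) ^ ((11 : ℝ) / 4) <
        ((halfSpaceCluster ω ∩ ((fun x => x + y) '' (↑(box 3 n) : Set (Site 3)))).ncard : ℝ)} ∩
      {ω | ∃ y : Site 3, (∃ i : Fin 3, (r : ℤ) ≤ |y i|) ∧ ω ∈ openConnIn Hs 0 y}) ≤
    C * ((r : ℝ) / n) ^ (3 : ℕ) * Real.exp (-c * lam ^ δ) *
      μc.real {ω | ∃ y : Site 3, (∃ i : Fin 3, (r : ℤ) ≤ |y i|) ∧ ω ∈ openConnIn Hs 0 y}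

/-- REGION-II STRIPPING (shape): on the two-arm event `J ⊆ tall_r(0) ∩ tall_r(e)`, the number of
pairs `(x ∈ C_ℍ(0) ∩ B_{2r}, z ∈ C_ℍ(e))` with `z - x ∈ B_n` is at most
`|C_ℍ(0) ∩ B_{2r}| · max_y |C_ℍ(e) ∩ (y + B_n)|` — a product of ONE-cluster functionals, each with a
tail statement (`MassTail`, `LocalMassTail`). Deterministic counting lemma. -/
theorem pairCount_le_mass_mul_localMax (X Z : Set (Site 3)) (hX : X.Finite) (hZ : Z.Finite) (r n : ℕ) :
    ((fun p : Site 3 × Site 3 => p) '' {p | p.1 ∈ X ∩ (↑(box 3 (2 * r)) : Set (Site 3)) ∧ p.2 ∈ Z ∧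
        p.2 - p.1 ∈ (↑(box 3 n) : Set (Site 3))}).ncard ≤
      (X ∩ (↑(box 3 (2 * r)) : Set (Site 3))).ncard *
        ⨆ y : Site 3, (Z ∩ ((fun x => x + y) '' (↑(box 3 n) : Set (Site 3)))).ncard := by
  sorry

end Summit.CriticalPhenomena.PercolationContinuityZ3.Cruxes.LowPointBookkeeping.SketchK1

end
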